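import Literature.Topology.FourManifolds.BandSumCommProofs
import Literature.Topology.FourManifolds.BandThickening
import HarnessLib

/-!
# Band sums at the attaching points, I: `K` arrives at `p` along `K₁` (junction analysis)

Fact seat `provefact-Literature.Topology.FourManifolds.BandData.isIsotopic_of_band_eq`; part of
the local analysis (LA) at the four attaching points needed to assemble the corrected geometric
heart `BandData.exists_ambientIsotopy_of_band_eq_of_isRegular` (`BandSumIsotopyRegular.lean`,
§ "Plan of the proof") from a planar two-arc lemma: near `p = band (0, -δ)` the planar lower arc
must be shown to be the graph of a function *flat* at the edge, which follows from the fact,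
proved here, that the band sum `K` arrives at `p` with the **same velocity direction as `K₁`**.
Everything in this file is proved; no named facts are introduced.

* `exists_pos_eq_smul_of_eventuallyEq_comp` (vector-space lemma): two curves `f`, `g` through a
  common point which agree, `f u = g (τ u)`, along a one-sided filter at the point with
  `τ u → a'` from the corresponding side, have positively proportional (nonzero) velocities —
  difference quotients and a pairing with `g'`.
* `Knot.exists_pos_deriv_curve_eq_smul_of_lift_left/right`: the knot form — if an arc of `K`
  ending (resp. starting) at a parameter `a` lies on `K'` with a strictly increasing lift `ψ`,
  then `(K.curve)' a = μ • (K'.curve)' (ψ 1)` (resp. `ψ 0`) with `μ > 0`.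
* `Knot.apply_circlePt_not_mem_image_Icc_of_mem_Ioo_left/right` (window lemmas complementing
  `KnotArcLift.lean`), `Knot.injOn_apply_circlePt_Ioo`.
* `BandData.leftEdge` — the closed left edge `s ↦ band (0, -δ + s (1 + 2δ))` as an arc on `K₁`
  (`leftEdge_mem`), its velocity (`deriv_coe_leftEdge`) and
  `BandData.strictMonoOn_lift_leftEdge`: **every lift of the left edge through `K₁` is
  increasing** (orientation clause `orient_left`; same argument as
  `BandData.strictMonoOn_lift_lowerArc` of `BandSumCommProofs.lean`);
  `range_left_inter_support : K₁ ∩ band (squareNhd δ) = leftEdge '' (0, 1)`.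
* Structure near `p` for a band injective on the closed collar `closedSquare δ` (which regular
  band data are) and disjoint summands: the attaching points are distinct
  (`band_lowerLeft_ne_lowerRight`, `band_lowerLeft_ne_upperLeft`), `p` is off the closed upper
  arc and off `K₂`; lifts `φ` of the lower arc and `χ` of the left edge exist, are strictly
  increasing on `[0, 1]` with windows shorter than the period (`lift_lowerCurve_one_lt`,
  `lift_leftEdge_one_lt`); just before `p` the knot `K₁` is off the band surface
  (`left_apply_circlePt_not_mem_support`) and the knot `K` runs on `K₁` off the band surface
  (`eventually_apply_circlePt_mem_left`), just after `p` it runs on the open lower arc.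
* `BandData.exists_pos_deriv_curve_eq_smul_left`: **`(K.curve)' (φ 0) = μ • (K₁.curve)' (χ 0)`,
  `μ > 0`** — the arc `C⁻` of `K` before `p` lifts to `K₁` with an increasing lift ending at
  `χ 0` (it avoids the open left edge, over which the parameters of `K₁` exceed `χ 0`).

## References

* P. R. Cromwell, *Knots and Links* (2004), §4.6 (the product `(L₁ - a) ∪ (L₂ - c) ∪ b ∪ d` of
  oriented knots along a rectangle `R` with `L₁ ∩ R = a`). [Cromwell2004]
* M. W. Hirsch, *Differential Topology* (1976), Ch. 1 §3 (embeddings), as used through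
  `KnotArcLift.lean` (lifts of arcs on a knot). [HirschDT1976]

## Design notes

* Unit-period parametrisations `K.curve = K ∘ circlePt` and lifts follow `KnotArcLift.lean` /
  `BandSumCommProofs.lean`; injectivity on the closed collar is taken as the hypothesis
  `InjOn band (closedSquare δ)` (from `BandData.IsRegular`, or from a `PatchThickening`), and
  disjointness of the summands as `Disjoint (range K₁) (range K₂)` (the tree's named fact
  `Knot.IsBandSum.disjoint_range`), both threaded explicitly.
* Local notation `𝔼 n`, `𝕊 n` follows the directory pattern. Nothing here uses `sorry`.
-/

open scoped Manifold ContDiff Topology Real RealInnerProductSpace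
open Function Set Metric Filter

noncomputable section

namespace Literature.Topology.FourManifolds

/-- Local notation: `𝔼 n` is the model Euclidean space `EuclideanSpace ℝ (Fin n)`. -/
local notation "𝔼 " n:arg => EuclideanSpace ℝ (Fin n)

/-- Local notation: `𝕊 n` is the unit sphere in `EuclideanSpace ℝ (Fin (n + 1))`. -/
local notation "𝕊 " n:arg => (Metric.sphere (0 : EuclideanSpace ℝ (Fin (n + 1))) 1)

/-! ## Velocities of two curves sharing a one-sided arc -/

section SharedArc

variable {E : Type*} [NormedAddCommGroup E] [InnerProductSpace ℝ E]

/-- **Two curves sharing a one-sided arc through a common point, traversed in the same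
direction, have positively proportional velocities there.** Let `f`, `g` be differentiable at
`a`, `a'` with `f a = g a'` and nonzero derivatives `f'`, `g'`, and suppose that along a filter
`l ≤ 𝓝[≠] a` one has `f u = g (τ u)` with `τ u → a'`, `τ u ≠ a'` and `(τ u - a')/(u - a) > 0`.
Then `f' = μ • g'` for some `μ > 0`. Proof: the difference quotient of `f` at `a` is
`(τ u - a')/(u - a)` times that of `g` at `a'` along `τ u`; pairing with `g'` shows that the ratio
converges (to `⟪f', g'⟫/‖g'‖²`), it is positive along `l`, and `f' ≠ 0`. [folklore] -/
theorem exists_pos_eq_smul_of_eventuallyEq_comp {f g : ℝ → E} {τ : ℝ → ℝ} {a a' : ℝ} {f' g' : E}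
    {l : Filter ℝ} [l.NeBot] (hl : l ≤ 𝓝[≠] a) (hf : HasDerivAt f f' a) (hg : HasDerivAt g g' a')
    (hfg : f a = g a') (heq : ∀ᶠ u in l, f u = g (τ u)) (hτ : Tendsto τ l (𝓝[≠] a'))
    (hsign : ∀ᶠ u in l, 0 < (τ u - a') / (u - a)) (hf' : f' ≠ 0) (hg' : g' ≠ 0) :
    ∃ μ : ℝ, 0 < μ ∧ f' = μ • g' := by
  -- difference quotients
  have hF : Tendsto (slope f a) l (𝓝 f') := (hasDerivAt_iff_tendsto_slope.1 hf).mono_left hl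
  have hG : Tendsto (fun u ↦ slope g a' (τ u)) l (𝓝 g') := (hasDerivAt_iff_tendsto_slope.1 hg).comp hτ
  set r : ℝ → ℝ := fun u ↦ (τ u - a') / (u - a) with hr
  have hne : ∀ᶠ u in l, u ≠ a := hl self_mem_nhdsWithin
  have hne' : ∀ᶠ u in l, τ u ≠ a' := hτ self_mem_nhdsWithin
  have hslope : ∀ᶠ u in l, slope f a u = r u • slope g a' (τ u) := by
    filter_upwards [heq, hne, hne'] with u hu hua hτa
    rw [slope_def_module, slope_def_module, hu, hfg, smul_smul]
    congr 1
    have h1 : u - a ≠ 0 := sub_ne_zero.2 hua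
    have h2 : τ u - a' ≠ 0 := sub_ne_zero.2 hτa
    rw [hr]
    field_simp
  -- pair with `g'`
  have hFi : Tendsto (fun u ↦ ⟪slope f a u, g'⟫) l (𝓝 ⟪f', g'⟫) := hF.inner tendsto_const_nhds
  have hGi : Tendsto (fun u ↦ ⟪slope g a' (τ u), g'⟫) l (𝓝 ⟪g', g'⟫) := hG.inner tendsto_const_nhds
  have hgg : ⟪g', g'⟫ ≠ 0 := by
    rw [real_inner_self_eq_norm_sq]
    exact pow_ne_zero 2 (norm_ne_zero_iff.2 hg')
  have hr_eq : ∀ᶠ u in l, r u = ⟪slope f a u, g'⟫ / ⟪slope g a' (τ u), g'⟫ := by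
    have hpos : ∀ᶠ u in l, ⟪slope g a' (τ u), g'⟫ ≠ 0 := hGi.eventually_ne hgg
    filter_upwards [hslope, hpos] with u hu hu'
    rw [hu, inner_smul_left, RCLike.conj_to_real, mul_div_assoc, div_self hu', mul_one]
  set μ : ℝ := ⟪f', g'⟫ / ⟪g', g'⟫ with hμ
  have hrμ : Tendsto r l (𝓝 μ) := (hFi.div hGi hgg).congr' (hr_eq.mono fun u hu ↦ hu.symm)
  -- the velocity relation
  have hlim : Tendsto (fun u ↦ r u • slope g a' (τ u)) l (𝓝 (μ • g')) := hrμ.smul hG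
  have hfeq : f' = μ • g' := tendsto_nhds_unique (hF.congr' hslope) hlim
  have hμ0 : 0 ≤ μ := ge_of_tendsto hrμ (hsign.mono fun u hu ↦ hu.le)
  refine ⟨μ, lt_of_le_of_ne hμ0 fun h ↦ hf' ?_, hfeq⟩
  rw [hfeq, ← h, zero_smul]

end SharedArc

namespace Knot

variable (K : Knot)

/-! ## Windows of lifts: parameters next to the window avoid the closed arc -/

/-- **Parameters just outside the window of a lift avoid the closed arc.** If `φ` (continuous on
`[0, 1]`, strictly increasing on `(0, 1)`) lifts the arc `γ` on `[0, 1]` through `K ∘ circlePt`,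
then a parameter `t` in `(φ 1 - 1, φ 0)` (just left of the window) does not map to the closed
arc `γ '' [0, 1]`. [folklore] -/
theorem apply_circlePt_not_mem_image_Icc_of_mem_Ioo_left {γ : ℝ → 𝕊 3} {φ : ℝ → ℝ}
    (hφ : ContinuousOn φ (Icc 0 1)) (hmono : StrictMonoOn φ (Ioo 0 1))
    (heq : ∀ s ∈ Icc (0 : ℝ) 1, K (circlePt (φ s)) = γ s) {t : ℝ}
    (ht : t ∈ Ioo (φ 1 - 1) (φ 0)) : K (circlePt t) ∉ γ '' Icc 0 1 := by
  rintro ⟨s, hs, hst⟩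
  rw [← heq s hs, eq_comm, K.apply_circlePt_eq_iff] at hst
  obtain ⟨m, hm⟩ := hst
  have hmono' := (strictMonoOn_Icc_of_Ioo hφ hmono).monotoneOn
  have h0 : φ 0 ≤ φ s := hmono' (left_mem_Icc.2 zero_le_one) hs hs.1
  have h1 : φ s ≤ φ 1 := hmono' hs (right_mem_Icc.2 zero_le_one) hs.2
  have hlt : (-1 : ℝ) < m := by linarith [ht.1]
  have hgt : (m : ℝ) < 0 := by linarith [ht.2]
  have h1' : (-1 : ℤ) < m := by exact_mod_cast hlt
  have h2' : m < (0 : ℤ) := by exact_mod_cast hgt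
  omega

/-- Symmetrically, a parameter in `(φ 1, φ 0 + 1)` (just right of the window) does not map to
the closed arc. [folklore] -/
theorem apply_circlePt_not_mem_image_Icc_of_mem_Ioo_right {γ : ℝ → 𝕊 3} {φ : ℝ → ℝ}
    (hφ : ContinuousOn φ (Icc 0 1)) (hmono : StrictMonoOn φ (Ioo 0 1))
    (heq : ∀ s ∈ Icc (0 : ℝ) 1, K (circlePt (φ s)) = γ s) {t : ℝ}
    (ht : t ∈ Ioo (φ 1) (φ 0 + 1)) : K (circlePt t) ∉ γ '' Icc 0 1 := by
  rintro ⟨s, hs, hst⟩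
  rw [← heq s hs, eq_comm, K.apply_circlePt_eq_iff] at hst
  obtain ⟨m, hm⟩ := hst
  have hmono' := (strictMonoOn_Icc_of_Ioo hφ hmono).monotoneOn
  have h0 : φ 0 ≤ φ s := hmono' (left_mem_Icc.2 zero_le_one) hs hs.1
  have h1 : φ s ≤ φ 1 := hmono' hs (right_mem_Icc.2 zero_le_one) hs.2
  have hlt : (0 : ℝ) < m := by linarith [ht.1]
  have hgt : (m : ℝ) < 1 := by linarith [ht.2]
  have h1' : (0 : ℤ) < m := by exact_mod_cast hlt
  have h2' : m < (1 : ℤ) := by exact_mod_cast hgt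
  omega

/-! ## Knots sharing a one-sided arc have positively proportional velocities -/

/-- **Incoming shared arc.** If the arc `s ↦ K (circlePt (a - κ + κ s))`, `0 ≤ s ≤ 1`, of the knot
`K` ending at the parameter `a` lies on the knot `K'` with a strictly increasing continuous lift
`ψ` (`K' (circlePt (ψ s)) = K (circlePt (a - κ + κ s))`), then the velocity of `K.curve` at `a`
is a positive multiple of the velocity of `K'.curve` at `ψ 1`
(`exists_pos_eq_smul_of_eventuallyEq_comp` along `u → a⁻`). [folklore] -/
theorem exists_pos_deriv_curve_eq_smul_of_lift_left (K' : Knot) {a κ : ℝ} (hκ : 0 < κ) {ψ : ℝ → ℝ}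
    (hψ : ContinuousOn ψ (Icc 0 1)) (hmono : StrictMonoOn ψ (Icc 0 1))
    (heq : ∀ s ∈ Icc (0 : ℝ) 1, K' (circlePt (ψ s)) = K (circlePt (a - κ + κ * s))) :
    ∃ μ : ℝ, 0 < μ ∧ deriv K.curve a = μ • deriv K'.curve (ψ 1) := by
  set σ : ℝ → ℝ := fun u ↦ (u - a + κ) / κ with hσ
  have hσa : σ a = 1 := by simp [hσ, hκ.ne']
  have hσu : ∀ u, a - κ + κ * σ u = u := fun u ↦ by simp only [hσ]; field_simp; ring
  have hσc : Continuous σ := by simp only [hσ]; fun_prop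
  -- the one-sided neighbourhood `[a - κ, a)` and the parameter `σ u ∈ [0, 1)` there
  have hmem : ∀ᶠ u in 𝓝[<] a, u ∈ Ico (a - κ) a := Ico_mem_nhdsLT (by linarith)
  have hσmem : ∀ u ∈ Ico (a - κ) a, σ u ∈ Ico (0 : ℝ) 1 := fun u hu ↦ by
    simp only [hσ, mem_Ico]
    constructor
    · exact div_nonneg (by linarith [hu.1]) hκ.le
    · rw [div_lt_one hκ]; linarith [hu.2]
  refine exists_pos_eq_smul_of_eventuallyEq_comp (l := 𝓝[<] a) (τ := ψ ∘ σ)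
    (nhdsWithin_mono a fun u (hu : u < a) ↦ hu.ne)
    ((K.contDiff_curve.differentiable (by simp)) a).hasDerivAt
    ((K'.contDiff_curve.differentiable (by simp)) (ψ 1)).hasDerivAt ?_ ?_ ?_ ?_
    (K.deriv_curve_ne_zero a) (K'.deriv_curve_ne_zero (ψ 1))
  · -- common point
    have h := heq 1 (right_mem_Icc.2 zero_le_one)
    rw [mul_one, sub_add_cancel] at h
    simp only [Knot.curve_apply, h]
  · -- the shared arc
    filter_upwards [hmem] with u hu
    have h := heq (σ u) (Ico_subset_Icc_self (hσmem u hu))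
    rw [hσu] at h
    simp only [Knot.curve_apply, comp_apply, h]
  · -- `ψ (σ u) → ψ 1` with values `≠ ψ 1`
    refine tendsto_nhdsWithin_iff.2 ⟨?_, ?_⟩
    · have h1 : Tendsto σ (𝓝[<] a) (𝓝[Icc 0 1] 1) :=
        tendsto_nhdsWithin_of_tendsto_nhds_of_eventually_within _
          (by simpa [hσa] using (hσc.tendsto a).mono_left nhdsWithin_le_nhds)
          (hmem.mono fun u hu ↦ Ico_subset_Icc_self (hσmem u hu))
      simpa [hσa] using ((hψ 1 (right_mem_Icc.2 zero_le_one)).tendsto).comp h1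
    · filter_upwards [hmem] with u hu
      exact (hmono (Ico_subset_Icc_self (hσmem u hu)) (right_mem_Icc.2 zero_le_one) (hσmem u hu).2).ne
  · -- same direction: both differences are negative
    filter_upwards [hmem] with u hu
    have h1 : ψ (σ u) - ψ 1 < 0 :=
      sub_neg.2 (hmono (Ico_subset_Icc_self (hσmem u hu)) (right_mem_Icc.2 zero_le_one) (hσmem u hu).2)
    have h2 : u - a < 0 := sub_neg.2 hu.2
    exact div_pos_of_neg_of_neg h1 h2

/-- **Outgoing shared arc.** If the arc `s ↦ K (circlePt (a + κ s))`, `0 ≤ s ≤ 1`, of `K`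
starting at the parameter `a` lies on `K'` with a strictly increasing continuous lift `ψ`, then
the velocity of `K.curve` at `a` is a positive multiple of the velocity of `K'.curve` at `ψ 0`.
[folklore] -/
theorem exists_pos_deriv_curve_eq_smul_of_lift_right (K' : Knot) {a κ : ℝ} (hκ : 0 < κ) {ψ : ℝ → ℝ}
    (hψ : ContinuousOn ψ (Icc 0 1)) (hmono : StrictMonoOn ψ (Icc 0 1))
    (heq : ∀ s ∈ Icc (0 : ℝ) 1, K' (circlePt (ψ s)) = K (circlePt (a + κ * s))) :
    ∃ μ : ℝ, 0 < μ ∧ deriv K.curve a = μ • deriv K'.curve (ψ 0) := by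
  set σ : ℝ → ℝ := fun u ↦ (u - a) / κ with hσ
  have hσa : σ a = 0 := by simp [hσ]
  have hσu : ∀ u, a + κ * σ u = u := fun u ↦ by simp only [hσ]; field_simp; ring
  have hσc : Continuous σ := by simp only [hσ]; fun_prop
  have hmem : ∀ᶠ u in 𝓝[>] a, u ∈ Ioc a (a + κ) := Ioc_mem_nhdsGT (by linarith)
  have hσmem : ∀ u ∈ Ioc a (a + κ), σ u ∈ Ioc (0 : ℝ) 1 := fun u hu ↦ by
    simp only [hσ, mem_Ioc]
    constructor
    · exact div_pos (by linarith [hu.1]) hκ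
    · rw [div_le_one hκ]; linarith [hu.2]
  refine exists_pos_eq_smul_of_eventuallyEq_comp (l := 𝓝[>] a) (τ := ψ ∘ σ)
    (nhdsWithin_mono a fun u (hu : a < u) ↦ hu.ne')
    ((K.contDiff_curve.differentiable (by simp)) a).hasDerivAt
    ((K'.contDiff_curve.differentiable (by simp)) (ψ 0)).hasDerivAt ?_ ?_ ?_ ?_
    (K.deriv_curve_ne_zero a) (K'.deriv_curve_ne_zero (ψ 0))
  · have h := heq 0 (left_mem_Icc.2 zero_le_one)
    rw [mul_zero, add_zero] at h
    simp only [Knot.curve_apply, h]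
  · filter_upwards [hmem] with u hu
    have h := heq (σ u) (Ioc_subset_Icc_self (hσmem u hu))
    rw [hσu] at h
    simp only [Knot.curve_apply, comp_apply, h]
  · refine tendsto_nhdsWithin_iff.2 ⟨?_, ?_⟩
    · have h1 : Tendsto σ (𝓝[>] a) (𝓝[Icc 0 1] 0) :=
        tendsto_nhdsWithin_of_tendsto_nhds_of_eventually_within _
          (by simpa [hσa] using (hσc.tendsto a).mono_left nhdsWithin_le_nhds)
          (hmem.mono fun u hu ↦ Ioc_subset_Icc_self (hσmem u hu))
      simpa [hσa] using ((hψ 0 (left_mem_Icc.2 zero_le_one)).tendsto).comp h1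
    · filter_upwards [hmem] with u hu
      exact (hmono (left_mem_Icc.2 zero_le_one) (Ioc_subset_Icc_self (hσmem u hu)) (hσmem u hu).1).ne'
  · filter_upwards [hmem] with u hu
    have h1 : 0 < ψ (σ u) - ψ 0 :=
      sub_pos.2 (hmono (left_mem_Icc.2 zero_le_one) (Ioc_subset_Icc_self (hσmem u hu)) (hσmem u hu).1)
    have h2 : 0 < u - a := sub_pos.2 hu.1
    exact div_pos h1 h2

end Knot

/-! ## The left edge of the band as an arc on `K₁` -/

/-- Affine reparametrisation lemma for `pt2`: `(a, c + s d) = (a, c) + s • (0, d)`. [folklore] -/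
theorem pt2_add_mul (a c d s : ℝ) : pt2 a (c + s * d) = pt2 a c + s • pt2 0 d := by
  ext i
  fin_cases i <;> simp [pt2]

namespace BandData

variable {K₁ K₂ K : Knot} {avoid : Set (𝕊 3)} (b : BandData K₁ K₂ K avoid)

/-- The planar left edge of the collar square, parametrised by `[0, 1]`:
`s ↦ (0, -δ + s (1 + 2δ))`. [folklore] -/
def leftEdgePlanar (s : ℝ) : 𝔼 2 := pt2 0 (-b.δ + s * (1 + 2 * b.δ))

/-- **The closed left edge of the band** as an arc `[0, 1] → 𝕊³` from the lower attaching point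
`band (0, -δ)` to the upper one `band (0, 1 + δ)`; it lies on `K₁` (`leftEdge_mem`). [folklore] -/
def leftEdge (s : ℝ) : 𝕊 3 := b.band (b.leftEdgePlanar s)

/-- Unfolding of `leftEdge`. [folklore] -/
theorem leftEdge_apply (s : ℝ) : b.leftEdge s = b.band (pt2 0 (-b.δ + s * (1 + 2 * b.δ))) := rfl

/-- The left edge starts at the lower-left attaching point. [folklore] -/
@[simp]
theorem leftEdge_zero : b.leftEdge 0 = b.band (pt2 0 (-b.δ)) := by
  simp [leftEdge_apply]

/-- The left edge ends at the upper-left attaching point. [folklore] -/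
@[simp]
theorem leftEdge_one : b.leftEdge 1 = b.band (pt2 0 (1 + b.δ)) := by
  rw [leftEdge_apply]; congr 2; ring

/-- The mid-point of the left edge is `band (0, 1/2)`. [folklore] -/
theorem leftEdge_half : b.leftEdge 2⁻¹ = b.band (pt2 0 2⁻¹) := by
  rw [leftEdge_apply]; congr 2; ring

/-- The planar left edge is smooth. [folklore] -/
theorem contDiff_leftEdgePlanar : ContDiff ℝ ∞ b.leftEdgePlanar := by
  have : b.leftEdgePlanar = fun s ↦ pt2 0 (-b.δ) + s • pt2 0 (1 + 2 * b.δ) :=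
    funext fun s ↦ pt2_add_mul 0 _ _ s
  rw [this]
  exact contDiff_const.add (contDiff_id.smul contDiff_const)

/-- The velocity of the planar left edge. [folklore] -/
theorem deriv_leftEdgePlanar (s : ℝ) : deriv b.leftEdgePlanar s = (1 + 2 * b.δ) • pt2 0 1 := by
  have : b.leftEdgePlanar = fun s ↦ pt2 0 (-b.δ) + s • pt2 0 (1 + 2 * b.δ) :=
    funext fun s ↦ pt2_add_mul 0 _ _ s
  rw [this]
  have h : HasDerivAt (fun s : ℝ ↦ pt2 0 (-b.δ) + s • pt2 0 (1 + 2 * b.δ)) (pt2 0 (1 + 2 * b.δ)) s := by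
    simpa using ((hasDerivAt_id s).smul_const (pt2 0 (1 + 2 * b.δ))).const_add (pt2 0 (-b.δ))
  rw [h.deriv]
  ext i
  fin_cases i <;> simp [pt2]

/-- The left edge is a smooth curve in `𝕊³`. [folklore] -/
theorem contMDiff_leftEdge : ContMDiff 𝓘(ℝ, ℝ) (𝓡 3) ∞ b.leftEdge :=
  b.contMDiff_band_comp b.contDiff_leftEdgePlanar

/-- The parameter of the planar left edge on `(0, 1)` lies in the open collar square, on the line
`x₀ = 0`. [folklore] -/
theorem leftEdgePlanar_mem {s : ℝ} (hs : s ∈ Ioo (0 : ℝ) 1) :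
    b.leftEdgePlanar s ∈ squareNhd b.δ ∧ b.leftEdgePlanar s 0 = 0 := by
  have hδ := b.δ_pos
  refine ⟨fun i ↦ ?_, rfl⟩
  fin_cases i
  · exact ⟨by simp [leftEdgePlanar, pt2]; linarith, by simp [leftEdgePlanar, pt2]; linarith⟩
  · simp only [leftEdgePlanar, pt2]
    constructor
    · show -b.δ < -b.δ + s * (1 + 2 * b.δ); nlinarith [hs.1]
    · show -b.δ + s * (1 + 2 * b.δ) < 1 + b.δ; nlinarith [hs.2]

/-- The height of the planar left edge lies in `[-δ, 1 + δ]` for `s ∈ [0, 1]`. [folklore] -/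
theorem leftEdge_height_mem {s : ℝ} (hs : s ∈ Icc (0 : ℝ) 1) :
    -b.δ + s * (1 + 2 * b.δ) ∈ Icc (-b.δ) (1 + b.δ) := by
  have hδ := b.δ_pos
  constructor <;> nlinarith [hs.1, hs.2]

/-- **The closed left edge lies on `K₁`.** [folklore] -/
theorem leftEdge_mem {s : ℝ} (hs : s ∈ Icc (0 : ℝ) 1) : b.leftEdge s ∈ range K₁ :=
  b.band_pt2_zero_mem (b.leftEdge_height_mem hs)

/-- The open left edge is injective. [folklore] -/
theorem injOn_leftEdge : InjOn b.leftEdge (Ioo 0 1) := by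
  intro s hs s' hs' h
  have hδ := b.δ_pos
  have h1 := b.injOn (b.leftEdgePlanar_mem hs).1 (b.leftEdgePlanar_mem hs').1 h
  have h2 := congrArg (fun x : 𝔼 2 ↦ x 1) h1
  simp only [leftEdgePlanar, pt2_apply_one] at h2
  nlinarith [h2]

/-- **Velocity of the left edge**: `(1 + 2δ)` times the derivative of the band in the vertical
direction `(0, 1)`. [folklore] -/
theorem deriv_coe_leftEdge (s : ℝ) :
    deriv (fun s ↦ (b.leftEdge s : 𝔼 4)) s =
      (1 + 2 * b.δ) • fderiv ℝ (fun x ↦ (b.band x : 𝔼 4)) (b.leftEdgePlanar s) (pt2 0 1) := by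
  rw [show (fun s ↦ (b.leftEdge s : 𝔼 4)) = fun s ↦ (b.band (b.leftEdgePlanar s) : 𝔼 4) from rfl,
    b.deriv_coe_band_comp b.contDiff_leftEdgePlanar, deriv_leftEdgePlanar, map_smul]

/-- **The left edge is traversed upwards by every lift.** A continuous lift `χ` of the closed
left edge through `K₁ ∘ circlePt` is strictly increasing on `(0, 1)`: strictly monotone because
the edge is injective, and increasing by the orientation clause `orient_left` (at the mid-point
`band (0, 1/2)` the velocity of `K₁` is a positive multiple of `∂band/∂x₁`). Same argument as
`strictMonoOn_lift_lowerArc` (`BandSumCommProofs.lean`). [folklore] -/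
theorem strictMonoOn_lift_leftEdge {χ : ℝ → ℝ} (hχ : Continuous χ)
    (hχe : ∀ s ∈ Icc (0 : ℝ) 1, K₁ (circlePt (χ s)) = b.leftEdge s) :
    StrictMonoOn χ (Ioo 0 1) := by
  have hδ := b.δ_pos
  rcases K₁.strictMonoOn_or_strictAntiOn_lift zero_lt_one hχ.continuousOn
    (fun s hs ↦ hχe s (Ioo_subset_Icc_self hs)) b.injOn_leftEdge with h | h
  · exact h
  exfalso
  have hhalf : (2⁻¹ : ℝ) ∈ Ioo (0 : ℝ) 1 := ⟨by norm_num, by norm_num⟩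
  have hle : deriv χ 2⁻¹ ≤ 0 := deriv_nonpos_of_strictAntiOn_Ioo h hhalf
  obtain ⟨θ, c, hc, hpt, hder⟩ := b.orient_left
  have hev : ∀ᶠ s in 𝓝 (2⁻¹ : ℝ), K₁ (circlePt (χ s)) = b.leftEdge s := by
    filter_upwards [Icc_mem_nhds hhalf.1 hhalf.2] with s hs using hχe s hs
  have hvel := K₁.deriv_coe_eq_deriv_lift_smul b.contMDiff_leftEdge.contMDiffAt hχ.continuousAt hev
  rw [b.deriv_coe_leftEdge] at hvel
  have hplanar : b.leftEdgePlanar 2⁻¹ = pt2 0 2⁻¹ := by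
    simp only [leftEdgePlanar]; congr 1; ring
  rw [hplanar] at hvel
  -- identify `θ` with `χ (1/2)` modulo the period
  have hθ : ∃ m : ℤ, (2 * π)⁻¹ * θ = χ 2⁻¹ + m := by
    rw [← K₁.apply_circlePt_eq_iff, circlePt_eq_circlePoint, mul_inv_cancel_left₀ (by positivity),
      hpt, hχe _ (Ioo_subset_Icc_self hhalf), leftEdge_half]
  obtain ⟨m, hm⟩ := hθ
  rw [K₁.deriv_coe_apply_circlePoint, hm, K₁.deriv_curve_add_int] at hder
  -- `hder : (2π)⁻¹ • V = c • fderiv … (pt2 0 1)`, `hvel : (1 + 2δ) • fderiv … (pt2 0 1) = χ' • V`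
  have hV := K₁.deriv_curve_ne_zero (χ 2⁻¹)
  have hfd : fderiv ℝ (fun x ↦ (b.band x : 𝔼 4)) (pt2 0 2⁻¹) (pt2 0 1) =
      ((1 + 2 * b.δ)⁻¹ * deriv χ 2⁻¹) • deriv K₁.curve (χ 2⁻¹) := by
    rw [← smul_smul, ← hvel, smul_smul, inv_mul_cancel₀ (by linarith), one_smul]
  rw [hfd, smul_smul] at hder
  have h1 : (2 * π)⁻¹ = c * ((1 + 2 * b.δ)⁻¹ * deriv χ 2⁻¹) := smul_left_injective ℝ hV hder
  have h2 : 0 < c * ((1 + 2 * b.δ)⁻¹ * deriv χ 2⁻¹) := by rw [← h1]; positivity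
  have h3 : c * ((1 + 2 * b.δ)⁻¹ * deriv χ 2⁻¹) ≤ 0 :=
    mul_nonpos_of_nonneg_of_nonpos hc.le (mul_nonpos_of_nonneg_of_nonpos (by positivity) hle)
  linarith

end BandData

/-! ## The lower-left attaching point: structure of `K` and `K₁` near `p = band (0, -δ)` -/

namespace BandData

variable {K₁ K₂ K : Knot} {avoid : Set (𝕊 3)} (b : BandData K₁ K₂ K avoid)

/-- The closed lower arc `[0, 1] → 𝕊³`, `s ↦ band (lowerArc s)`, from `p = band (0, -δ)` to
`p' = band (1, -δ)`. [folklore] -/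
def lowerCurve (s : ℝ) : 𝕊 3 := b.band (b.lowerArc s)

/-- The closed upper arc `[0, 1] → 𝕊³`, `s ↦ band (upperArc s)`. [folklore] -/
def upperCurve (s : ℝ) : 𝕊 3 := b.band (b.upperArc s)

/-- Unfolding of `lowerCurve`. [folklore] -/
@[simp] theorem lowerCurve_apply (s : ℝ) : b.lowerCurve s = b.band (b.lowerArc s) := rfl

/-- Unfolding of `upperCurve`. [folklore] -/
@[simp] theorem upperCurve_apply (s : ℝ) : b.upperCurve s = b.band (b.upperArc s) := rfl

/-- The lower curve starts at `p = band (0, -δ)`. [folklore] -/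
theorem lowerCurve_zero : b.lowerCurve 0 = b.band (pt2 0 (-b.δ)) := by simp [b.lowerArc_zero]

/-- The lower curve ends at `p' = band (1, -δ)`. [folklore] -/
theorem lowerCurve_one : b.lowerCurve 1 = b.band (pt2 1 (-b.δ)) := by simp [b.lowerArc_one]

/-- The lower curve is continuous. [folklore] -/
theorem continuous_lowerCurve : Continuous b.lowerCurve :=
  (b.contMDiff_band_comp b.contDiff_lowerArc).continuous

/-- The upper curve is continuous. [folklore] -/
theorem continuous_upperCurve : Continuous b.upperCurve :=
  (b.contMDiff_band_comp b.contDiff_upperArc).continuous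

/-- A point `(a, c)` lies in the closed collar square iff both coordinates lie in `[-δ, 1 + δ]`.
[folklore] -/
theorem _root_.Literature.Topology.FourManifolds.pt2_mem_closedSquare_iff {a c δ : ℝ} :
    pt2 a c ∈ closedSquare δ ↔ a ∈ Icc (-δ) (1 + δ) ∧ c ∈ Icc (-δ) (1 + δ) := by
  simp only [closedSquare, mem_setOf_eq, Fin.forall_fin_two]
  exact Iff.rfl

/-- The four attaching points lie in the closed collar square. [folklore] -/
theorem corner_mem_closedSquare {a c : ℝ} (ha : a = 0 ∨ a = 1) (hc : c = -b.δ ∨ c = 1 + b.δ) :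
    pt2 a c ∈ closedSquare b.δ := by
  have hδ := b.δ_pos
  rw [pt2_mem_closedSquare_iff]
  rcases ha with rfl | rfl <;> rcases hc with rfl | rfl <;>
    exact ⟨⟨by linarith, by linarith⟩, ⟨by linarith, by linarith⟩⟩

/-- The parameters of the closed lower arc lie in the closed collar square. [folklore] -/
theorem lowerArc_mem_closedSquare {s : ℝ} (hs : s ∈ Icc (0 : ℝ) 1) : b.lowerArc s ∈ closedSquare b.δ := by
  rcases hs.1.eq_or_lt with rfl | h0
  · rw [b.lowerArc_zero]; exact b.corner_mem_closedSquare (Or.inl rfl) (Or.inl rfl)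
  rcases hs.2.eq_or_lt with rfl | h1
  · rw [b.lowerArc_one]; exact b.corner_mem_closedSquare (Or.inr rfl) (Or.inl rfl)
  exact squareNhd_subset_closedSquare _ (b.lowerArc_mem s ⟨h0, h1⟩).1

/-- The parameters of the closed upper arc lie in the closed collar square. [folklore] -/
theorem upperArc_mem_closedSquare {s : ℝ} (hs : s ∈ Icc (0 : ℝ) 1) : b.upperArc s ∈ closedSquare b.δ := by
  rcases hs.1.eq_or_lt with rfl | h0
  · rw [b.upperArc_zero]; exact b.corner_mem_closedSquare (Or.inr rfl) (Or.inr rfl)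
  rcases hs.2.eq_or_lt with rfl | h1
  · rw [b.upperArc_one]; exact b.corner_mem_closedSquare (Or.inl rfl) (Or.inr rfl)
  exact squareNhd_subset_closedSquare _ (b.upperArc_mem s ⟨h0, h1⟩).1

/-- The second coordinate of a parameter of the closed upper arc is at least `1/2`. [folklore] -/
theorem half_le_upperArc_apply_one {s : ℝ} (hs : s ∈ Icc (0 : ℝ) 1) : 2⁻¹ ≤ b.upperArc s 1 := by
  have hδ := b.δ_pos
  rcases hs.1.eq_or_lt with rfl | h0
  · rw [b.upperArc_zero, pt2_apply_one]; linarith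
  rcases hs.2.eq_or_lt with rfl | h1
  · rw [b.upperArc_one, pt2_apply_one]; linarith
  exact (b.upperArc_mem s ⟨h0, h1⟩).2.le

/-- For a band injective on the closed collar, the two lower attaching points differ:
`band (0, -δ) ≠ band (1, -δ)`. [folklore] -/
theorem band_lowerLeft_ne_lowerRight (hcl : InjOn b.band (closedSquare b.δ)) :
    b.band (pt2 0 (-b.δ)) ≠ b.band (pt2 1 (-b.δ)) := by
  intro h
  have h1 := hcl (b.corner_mem_closedSquare (Or.inl rfl) (Or.inl rfl))
    (b.corner_mem_closedSquare (Or.inr rfl) (Or.inl rfl)) h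
  have := congrArg (fun x : 𝔼 2 ↦ x 0) h1
  simp at this

/-- For a band injective on the closed collar, the two left attaching points differ:
`band (0, -δ) ≠ band (0, 1 + δ)`. [folklore] -/
theorem band_lowerLeft_ne_upperLeft (hcl : InjOn b.band (closedSquare b.δ)) :
    b.band (pt2 0 (-b.δ)) ≠ b.band (pt2 0 (1 + b.δ)) := by
  have hδ := b.δ_pos
  intro h
  have h1 := hcl (b.corner_mem_closedSquare (Or.inl rfl) (Or.inl rfl))
    (b.corner_mem_closedSquare (Or.inl rfl) (Or.inr rfl)) h
  have := congrArg (fun x : 𝔼 2 ↦ x 1) h1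
  simp at this
  linarith

/-- For a band injective on the closed collar, the lower-left attaching point is not on the closed
upper arc. [folklore] -/
theorem band_lowerLeft_not_mem_upperCurve (hcl : InjOn b.band (closedSquare b.δ)) :
    b.band (pt2 0 (-b.δ)) ∉ b.upperCurve '' Icc 0 1 := by
  have hδ := b.δ_pos
  rintro ⟨s, hs, h⟩
  have h1 := hcl (b.upperArc_mem_closedSquare hs) (b.corner_mem_closedSquare (Or.inl rfl) (Or.inl rfl)) h
  have h2 := b.half_le_upperArc_apply_one hs
  rw [h1, pt2_apply_one] at h2
  linarith

/-- The lower-left attaching point lies on `K₁`. [folklore] -/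
theorem band_lowerLeft_mem_range_left : b.band (pt2 0 (-b.δ)) ∈ range K₁ :=
  b.band_pt2_zero_mem ⟨le_rfl, by linarith [b.δ_pos]⟩

/-- If the summands are disjoint, the lower-left attaching point is not on `K₂`. [folklore] -/
theorem band_lowerLeft_not_mem_range_right (hdisj : Disjoint (range K₁) (range K₂)) :
    b.band (pt2 0 (-b.δ)) ∉ range K₂ :=
  Set.disjoint_left.1 hdisj b.band_lowerLeft_mem_range_left

/-! ### Lifts of the lower arc and of the left edge -/

/-- **A lift of the closed lower arc** through `K ∘ circlePt`: continuous, strictly increasing on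
`[0, 1]` (`strictMonoOn_lift_lowerArc`), with `K (circlePt (φ s)) = band (lowerArc s)`.
[folklore] -/
theorem exists_lift_lowerCurve :
    ∃ φ : ℝ → ℝ, Continuous φ ∧ StrictMonoOn φ (Icc 0 1) ∧
      ∀ s ∈ Icc (0 : ℝ) 1, K (circlePt (φ s)) = b.lowerCurve s := by
  obtain ⟨φ, hφ, hφℓ⟩ := K.exists_lift b.continuous_lowerCurve fun s hs ↦ b.band_lowerArc_mem hs
  exact ⟨φ, hφ, strictMonoOn_Icc_of_Ioo hφ.continuousOn (b.strictMonoOn_lift_lowerArc hφ hφℓ), hφℓ⟩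

/-- **A lift of the closed left edge** through `K₁ ∘ circlePt`: continuous, strictly increasing
on `[0, 1]` (`strictMonoOn_lift_leftEdge`), with `K₁ (circlePt (χ s)) = leftEdge s`. [folklore] -/
theorem exists_lift_leftEdge :
    ∃ χ : ℝ → ℝ, Continuous χ ∧ StrictMonoOn χ (Icc 0 1) ∧
      ∀ s ∈ Icc (0 : ℝ) 1, K₁ (circlePt (χ s)) = b.leftEdge s := by
  obtain ⟨χ, hχ, hχe⟩ := K₁.exists_lift b.contMDiff_leftEdge.continuous fun s hs ↦ b.leftEdge_mem hs
  exact ⟨χ, hχ, strictMonoOn_Icc_of_Ioo hχ.continuousOn (b.strictMonoOn_lift_leftEdge hχ hχe), hχe⟩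

/-- The window of a lift of the lower arc is shorter than the period (the endpoints `p ≠ p'` of
the arc are distinct). [folklore] -/
theorem lift_lowerCurve_one_lt (hcl : InjOn b.band (closedSquare b.δ)) {φ : ℝ → ℝ} (hφ : Continuous φ)
    (hmono : StrictMonoOn φ (Icc 0 1))
    (hφℓ : ∀ s ∈ Icc (0 : ℝ) 1, K (circlePt (φ s)) = b.lowerCurve s) : φ 1 < φ 0 + 1 := by
  refine lt_of_le_of_ne (K.lift_one_le hφ.continuousOn (hmono.mono Ioo_subset_Icc_self) hφℓ
    b.injOn_band_lowerArc) fun h ↦ b.band_lowerLeft_ne_lowerRight hcl ?_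
  rw [← lowerCurve_zero, ← lowerCurve_one, ← hφℓ 0 (left_mem_Icc.2 zero_le_one),
    ← hφℓ 1 (right_mem_Icc.2 zero_le_one), h, K.apply_circlePt_eq_iff]
  exact ⟨-1, by simp⟩

/-- The window of a lift of the left edge is shorter than the period (`p ≠ q`). [folklore] -/
theorem lift_leftEdge_one_lt (hcl : InjOn b.band (closedSquare b.δ)) {χ : ℝ → ℝ} (hχ : Continuous χ)
    (hmono : StrictMonoOn χ (Icc 0 1))
    (hχe : ∀ s ∈ Icc (0 : ℝ) 1, K₁ (circlePt (χ s)) = b.leftEdge s) : χ 1 < χ 0 + 1 := by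
  refine lt_of_le_of_ne (K₁.lift_one_le hχ.continuousOn (hmono.mono Ioo_subset_Icc_self) hχe
    b.injOn_leftEdge) fun h ↦ b.band_lowerLeft_ne_upperLeft hcl ?_
  rw [← leftEdge_zero, ← leftEdge_one, ← hχe 0 (left_mem_Icc.2 zero_le_one),
    ← hχe 1 (right_mem_Icc.2 zero_le_one), h, K₁.apply_circlePt_eq_iff]
  exact ⟨-1, by simp⟩

/-! ### `K₁` near `p`: the edge after, the arc `C⁻` before -/

/-- The image of the open left edge is the part of `K₁` in the band surface:
`K₁ ∩ band (squareNhd δ) = leftEdge '' (0, 1)`. [folklore] -/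
theorem range_left_inter_support : range K₁ ∩ b.support = b.leftEdge '' Ioo 0 1 := by
  have hδ := b.δ_pos
  ext c
  constructor
  · rintro ⟨hc, x, hx, rfl⟩
    have hmem : x ∈ b.band ⁻¹' range K₁ ∩ squareNhd b.δ := ⟨hc, hx⟩
    rw [b.preimage_left] at hmem
    -- `x = (0, y)` with `-δ < y < 1 + δ`; solve `y = -δ + s (1 + 2δ)`
    set s := (x 1 + b.δ) / (1 + 2 * b.δ) with hs
    have hy := hmem.1 1
    refine ⟨s, ⟨?_, ?_⟩, ?_⟩
    · rw [hs]; exact div_pos (by linarith [hy.1]) (by linarith)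
    · rw [hs, div_lt_one (by linarith)]; linarith [hy.2]
    · rw [leftEdge_apply]
      congr 1
      ext i
      fin_cases i
      · simpa [pt2] using hmem.2.symm
      · show -b.δ + s * (1 + 2 * b.δ) = x 1
        rw [hs]; field_simp; ring
  · rintro ⟨s, hs, rfl⟩
    exact ⟨b.leftEdge_mem (Ioo_subset_Icc_self hs), _, (b.leftEdgePlanar_mem hs).1, rfl⟩

/-- **Just before reaching `p`, the knot `K₁` is off the band surface**: for a lift `χ` of the
left edge and `t ∈ (χ 1 - 1, χ 0)`, the point `K₁ (circlePt t)` is not in `band (squareNhd δ)`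
(it is not on the closed left edge, by the window lemma, and `K₁` meets the band surface only
along the open edge). [folklore] -/
theorem left_apply_circlePt_not_mem_support {χ : ℝ → ℝ} (hχ : Continuous χ)
    (hmono : StrictMonoOn χ (Icc 0 1)) (hχe : ∀ s ∈ Icc (0 : ℝ) 1, K₁ (circlePt (χ s)) = b.leftEdge s)
    {t : ℝ} (ht : t ∈ Ioo (χ 1 - 1) (χ 0)) : K₁ (circlePt t) ∉ b.support := by
  intro h
  have hmem : K₁ (circlePt t) ∈ range K₁ ∩ b.support := ⟨mem_range_self _, h⟩
  rw [b.range_left_inter_support] at hmem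
  exact K₁.apply_circlePt_not_mem_image_Icc_of_mem_Ioo_left hχ.continuousOn
    (hmono.mono Ioo_subset_Icc_self) hχe ht (image_mono Ioo_subset_Icc_self hmem)

/-- Points of `K₁` off the band surface lie on `K` (`range_diff`). [folklore] -/
theorem mem_range_of_mem_range_left_of_not_mem_support {c : 𝕊 3} (hc : c ∈ range K₁)
    (hcs : c ∉ b.support) : c ∈ range K := by
  have : c ∈ (range K₁ ∪ range K₂) \ b.band '' squareNhd b.δ := ⟨Or.inl hc, hcs⟩
  rw [← b.range_diff] at this
  exact this.1

/-! ### `K` near `p`: the lower arc after, the arc `C⁻` before -/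

/-- **Just before reaching `p`, the knot `K` runs on `K₁` off the band surface.** For a lift `φ`
of the lower arc: eventually as `t → (φ 0)⁻`, `K (circlePt t) ∈ range K₁` and
`K (circlePt t) ∉ band (squareNhd δ)` (the point is near `p`, hence neither on the closed upper
arc nor on `K₂`, and it is not on the closed lower arc by the window lemma; so it is a point of
`K₁ ∪ K₂` off the band, `apply_mem_arcs_union`). [folklore] -/
theorem eventually_apply_circlePt_mem_left (hcl : InjOn b.band (closedSquare b.δ))
    (hdisj : Disjoint (range K₁) (range K₂)) {φ : ℝ → ℝ}
    (hφ : Continuous φ) (hmono : StrictMonoOn φ (Icc 0 1))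
    (hφℓ : ∀ s ∈ Icc (0 : ℝ) 1, K (circlePt (φ s)) = b.lowerCurve s) :
    ∀ᶠ t in 𝓝[<] (φ 0), K (circlePt t) ∈ range K₁ ∧ K (circlePt t) ∉ b.support := by
  have hδ := b.δ_pos
  have hp : K (circlePt (φ 0)) = b.band (pt2 0 (-b.δ)) := by
    rw [hφℓ 0 (left_mem_Icc.2 zero_le_one), lowerCurve_zero]
  have hcont : Tendsto (fun t ↦ K (circlePt t)) (𝓝[<] (φ 0)) (𝓝 (b.band (pt2 0 (-b.δ)))) := by
    rw [← hp]
    exact ((K.continuous.comp continuous_circlePt).tendsto (φ 0)).mono_left nhdsWithin_le_nhds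
  -- near `p`: off the closed upper arc and off `K₂`
  have hU : IsClosed (b.upperCurve '' Icc 0 1) :=
    (isCompact_Icc.image b.continuous_upperCurve).isClosed
  have h1 : ∀ᶠ t in 𝓝[<] (φ 0), K (circlePt t) ∉ b.upperCurve '' Icc 0 1 :=
    hcont (hU.isOpen_compl.mem_nhds (b.band_lowerLeft_not_mem_upperCurve hcl))
  have h2 : ∀ᶠ t in 𝓝[<] (φ 0), K (circlePt t) ∉ range K₂ :=
    hcont (K₂.isClosed_range.isOpen_compl.mem_nhds (b.band_lowerLeft_not_mem_range_right hdisj))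
  -- left of the window: off the closed lower arc
  have h3 : ∀ᶠ t in 𝓝[<] (φ 0), t ∈ Ioo (φ 1 - 1) (φ 0) :=
    Ioo_mem_nhdsLT (by linarith [b.lift_lowerCurve_one_lt hcl hφ hmono hφℓ])
  filter_upwards [h1, h2, h3] with t ht1 ht2 ht3
  have hnotL : K (circlePt t) ∉ b.lowerCurve '' Icc 0 1 :=
    K.apply_circlePt_not_mem_image_Icc_of_mem_Ioo_left hφ.continuousOn (hmono.mono Ioo_subset_Icc_self)
      hφℓ ht3
  have hcases := b.apply_mem_arcs_union (circlePt t)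
  have hK₁ : K (circlePt t) ∈ range K₁ := by
    rcases hcases with (hl | hu) | (h₁ | h₂)
    · exact absurd (image_mono Ioo_subset_Icc_self hl) hnotL
    · exact absurd (image_mono Ioo_subset_Icc_self hu) ht1
    · exact h₁
    · exact absurd h₂ ht2
  refine ⟨hK₁, fun hs ↦ ?_⟩
  -- a point of `K` in the band surface is on one of the open arcs
  obtain ⟨x, hx, hxe⟩ := hs
  have hmem : x ∈ b.band ⁻¹' range K ∩ squareNhd b.δ := ⟨⟨_, hxe.symm⟩, hx⟩
  rw [b.preimage_range] at hmem
  rcases hmem with ⟨s, hs, rfl⟩ | ⟨s, hs, rfl⟩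
  · exact hnotL ⟨s, Ioo_subset_Icc_self hs, hxe⟩
  · exact ht1 ⟨s, Ioo_subset_Icc_self hs, hxe⟩

/-- **Just after leaving `p`, the knot `K` runs along the open lower arc** (inside the band
surface). [folklore] -/
theorem apply_circlePt_mem_lowerCurve_image {φ : ℝ → ℝ} (hφ : Continuous φ)
    (hmono : StrictMonoOn φ (Icc 0 1)) (hφℓ : ∀ s ∈ Icc (0 : ℝ) 1, K (circlePt (φ s)) = b.lowerCurve s)
    {t : ℝ} (ht : t ∈ Ioo (φ 0) (φ 1)) : K (circlePt t) ∈ b.lowerCurve '' Ioo 0 1 :=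
  K.apply_circlePt_mem_image_of_lift hφ.continuousOn (hmono.mono Ioo_subset_Icc_self) hφℓ ht

end BandData

/-! ### The velocity of `K` at `p` is a positive multiple of the velocity of `K₁` at `p` -/

namespace BandData

variable {K₁ K₂ K : Knot} {avoid : Set (𝕊 3)} (b : BandData K₁ K₂ K avoid)

/-- `K ∘ circlePt` is injective on intervals shorter than the period. [folklore] -/
theorem _root_.Literature.Topology.FourManifolds.Knot.injOn_apply_circlePt_Ioo (K : Knot) {l u : ℝ}
    (hlu : u ≤ l + 1) : InjOn (fun t ↦ K (circlePt t)) (Ioo l u) := by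
  intro t ht t' ht' h
  obtain ⟨m, hm⟩ := (K.apply_circlePt_eq_iff).1 h
  have h1 : (-1 : ℝ) < m := by linarith [ht.1, ht'.2]
  have h2 : (m : ℝ) < 1 := by linarith [ht.2, ht'.1]
  have h1' : (-1 : ℤ) < m := by exact_mod_cast h1
  have h2' : m < (1 : ℤ) := by exact_mod_cast h2
  obtain rfl : m = 0 := by omega
  simpa using hm

/-- **`K` arrives at `p` along `K₁`, in the same direction.** For lifts `φ` of the lower arc
(through `K`) and `χ` of the left edge (through `K₁`), the velocity of `K.curve` at `φ 0` is a
positive multiple of the velocity of `K₁.curve` at `χ 0`: just before `p`, `K` runs on the arc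
`C⁻` of `K₁` off the band (`eventually_apply_circlePt_mem_left`); that arc lifts to `K₁` with a
strictly increasing lift ending at `χ 0` (it avoids the open left edge, over which the parameters
of `K₁` exceed `χ 0`), and `exists_pos_deriv_curve_eq_smul_of_lift_left` applies. [folklore] -/
theorem exists_pos_deriv_curve_eq_smul_left (hcl : InjOn b.band (closedSquare b.δ))
    (hdisj : Disjoint (range K₁) (range K₂)) {φ : ℝ → ℝ} (hφ : Continuous φ)
    (hφm : StrictMonoOn φ (Icc 0 1)) (hφℓ : ∀ s ∈ Icc (0 : ℝ) 1, K (circlePt (φ s)) = b.lowerCurve s)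
    {χ : ℝ → ℝ} (hχ : Continuous χ) (hχm : StrictMonoOn χ (Icc 0 1))
    (hχe : ∀ s ∈ Icc (0 : ℝ) 1, K₁ (circlePt (χ s)) = b.leftEdge s) :
    ∃ μ : ℝ, 0 < μ ∧ deriv K.curve (φ 0) = μ • deriv K₁.curve (χ 0) := by
  have hp : K (circlePt (φ 0)) = b.band (pt2 0 (-b.δ)) := by
    rw [hφℓ 0 (left_mem_Icc.2 zero_le_one), lowerCurve_zero]
  have hp₁ : K₁ (circlePt (χ 0)) = b.band (pt2 0 (-b.δ)) := by
    rw [hχe 0 (left_mem_Icc.2 zero_le_one), leftEdge_zero]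
  -- a one-sided interval `[φ 0 - κ, φ 0)` on which `K` runs on `K₁` off the band
  obtain ⟨l, hl, hlsub⟩ := mem_nhdsLT_iff_exists_Ioo_subset.1
    (b.eventually_apply_circlePt_mem_left hcl hdisj hφ hφm hφℓ)
  have hl' : l < φ 0 := hl
  set κ : ℝ := min ((φ 0 - l) / 2) 2⁻¹ with hκ
  have hκpos : 0 < κ := lt_min (by linarith) (by norm_num)
  have hκl : l < φ 0 - κ := by
    have : κ ≤ (φ 0 - l) / 2 := min_le_left _ _
    linarith
  have hκ1 : κ ≤ 2⁻¹ := min_le_right _ _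
  have hgood : ∀ t ∈ Ico (φ 0 - κ) (φ 0), K (circlePt t) ∈ range K₁ ∧ K (circlePt t) ∉ b.support :=
    fun t ht ↦ hlsub ⟨hκl.trans_le ht.1, ht.2⟩
  -- the arc `C⁻` reparametrised by `[0, 1]`, as an arc on `K₁`
  set γ : ℝ → 𝕊 3 := fun s ↦ K (circlePt (φ 0 - κ + κ * s)) with hγ
  have hγc : Continuous γ := (K.continuous.comp continuous_circlePt).comp (by fun_prop)
  have hpar : ∀ s ∈ Ico (0 : ℝ) 1, φ 0 - κ + κ * s ∈ Ico (φ 0 - κ) (φ 0) := fun s hs ↦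
    ⟨by nlinarith [hs.1], by nlinarith [hs.2]⟩
  have hγmem : ∀ s ∈ Icc (0 : ℝ) 1, γ s ∈ range K₁ := by
    intro s hs
    rcases hs.2.eq_or_lt with rfl | hs1
    · simp only [hγ, mul_one, sub_add_cancel, hp]
      exact b.band_lowerLeft_mem_range_left
    · exact (hgood _ (hpar s ⟨hs.1, hs1⟩)).1
  obtain ⟨ψ₀, hψ₀, hψ₀γ⟩ := K₁.exists_lift hγc hγmem
  -- normalise the lift so that it ends at `χ 0`
  have hend : ∃ m : ℤ, ψ₀ 1 = χ 0 + m := by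
    rw [← K₁.apply_circlePt_eq_iff, hψ₀γ 1 (right_mem_Icc.2 zero_le_one), hp₁]
    simp [hγ, hp]
  obtain ⟨m, hm⟩ := hend
  set ψ : ℝ → ℝ := fun s ↦ ψ₀ s - m with hψdef
  have hψc : Continuous ψ := hψ₀.sub continuous_const
  have hψ1 : ψ 1 = χ 0 := by simp [hψdef, hm]
  have hψγ : ∀ s ∈ Icc (0 : ℝ) 1, K₁ (circlePt (ψ s)) = γ s := fun s hs ↦ by
    rw [← hψ₀γ s hs]
    show K₁ (circlePt (ψ₀ s - m)) = K₁ (circlePt (ψ₀ s))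
    rw [show ψ₀ s - m = ψ₀ s + ((-m : ℤ) : ℝ) by push_cast; ring, circlePt_add_int]
  -- `γ` is injective on `(0, 1]`-type intervals: the parameters stay within half a period
  have hγinj : InjOn γ (Ioo 0 1) := by
    intro s hs s' hs' h
    have ht : φ 0 - κ + κ * s ∈ Ioo (φ 0 - κ) (φ 0) := ⟨by nlinarith [hs.1], by nlinarith [hs.2]⟩
    have ht' : φ 0 - κ + κ * s' ∈ Ioo (φ 0 - κ) (φ 0) := ⟨by nlinarith [hs'.1], by nlinarith [hs'.2]⟩
    have hi := K.injOn_apply_circlePt_Ioo (l := φ 0 - κ) (u := φ 0) (by linarith) ht ht' h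
    have : κ * s = κ * s' := by linarith
    exact mul_left_cancel₀ hκpos.ne' this
  -- `ψ s < ψ 1` on `(0, 1)`: otherwise `K₁ ∘ circlePt ∘ ψ` would enter the open left edge
  have hlt_end : ∀ s ∈ Ioo (0 : ℝ) 1, ψ s < ψ 1 := by
    intro s hs
    refine lt_of_not_ge fun hge ↦ ?_
    rcases hge.eq_or_lt with heq | hgt
    · -- `γ s = γ 1 = p` contradicts injectivity of `K ∘ circlePt` on a short interval
      have h1 : γ s = γ 1 := by rw [← hψγ s (Ioo_subset_Icc_self hs), ← hψγ 1 (right_mem_Icc.2 zero_le_one), heq]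
      have h1' : K (circlePt (φ 0 - κ + κ * s)) = K (circlePt (φ 0)) := by
        have := h1; simp only [hγ, mul_one, sub_add_cancel] at this; exact this
      have hi := K.injOn_apply_circlePt_Ioo (l := φ 0 - κ) (u := φ 0 + κ) (by linarith)
        ⟨by nlinarith [hs.1], by nlinarith [hs.2]⟩ ⟨by linarith, by linarith⟩ h1'
      have : κ * s = κ * 1 := by linarith
      exact hs.2.ne (mul_left_cancel₀ hκpos.ne' this)
    · -- some parameter in `[s, 1)` has lift in the window `(χ 0, χ 1)` of the open left edge
      have hχ01 : χ 0 < χ 1 := hχm (left_mem_Icc.2 zero_le_one) (right_mem_Icc.2 zero_le_one) zero_lt_one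
      obtain ⟨s', hs', hwin⟩ : ∃ s' ∈ Ico s 1, ψ s' ∈ Ioo (χ 0) (χ 1) := by
        by_cases hlt : ψ s < χ 1
        · exact ⟨s, ⟨le_rfl, hs.2⟩, ⟨hψ1 ▸ hgt, hlt⟩⟩
        · have hlt : χ 1 ≤ ψ s := le_of_not_gt hlt
          -- intermediate value on `[s, 1]` for the value `(χ 0 + χ 1)/2`
          have hmid : (χ 0 + χ 1) / 2 ∈ Icc (ψ 1) (ψ s) := ⟨by rw [hψ1]; linarith, by linarith⟩
          obtain ⟨s', hs'mem, hs'val⟩ := intermediate_value_Icc' hs.2.le hψc.continuousOn hmid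
          refine ⟨s', ⟨hs'mem.1, lt_of_le_of_ne hs'mem.2 fun h ↦ ?_⟩, ?_⟩
          · rw [h, hψ1] at hs'val; linarith
          · rw [hs'val]; constructor <;> linarith
      have hedge := K₁.apply_circlePt_mem_image_of_lift hχ.continuousOn (hχm.mono Ioo_subset_Icc_self) hχe hwin
      have hs'01 : s' ∈ Ico (0 : ℝ) 1 := ⟨hs.1.le.trans hs'.1, hs'.2⟩
      rw [hψγ s' (Ico_subset_Icc_self hs'01)] at hedge
      have hsupp : γ s' ∈ b.support := by
        rw [← b.range_left_inter_support] at hedge; exact hedge.2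
      exact (hgood _ (hpar s' hs'01)).2 hsupp
  -- hence `ψ` is strictly increasing
  have hψmono : StrictMonoOn ψ (Icc 0 1) := by
    rcases K₁.strictMonoOn_or_strictAntiOn_lift zero_lt_one hψc.continuousOn
      (fun s hs ↦ hψγ s (Ioo_subset_Icc_self hs)) hγinj with h | h
    · exact strictMonoOn_Icc_of_Ioo hψc.continuousOn h
    · exfalso
      have hneg : StrictMonoOn (fun s ↦ -ψ s) (Icc 0 1) :=
        strictMonoOn_Icc_of_Ioo hψc.neg.continuousOn fun x hx y hy hxy ↦ neg_lt_neg (h hx hy hxy)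
      have h1 := hneg (Ioo_subset_Icc_self ⟨one_half_pos, one_half_lt_one⟩) (right_mem_Icc.2 zero_le_one)
        one_half_lt_one
      have h2 := hlt_end 2⁻¹ ⟨by norm_num, by norm_num⟩
      simp only [one_div] at h1
      linarith
  -- conclude by the shared-arc lemma
  obtain ⟨μ, hμ, hvel⟩ := K.exists_pos_deriv_curve_eq_smul_of_lift_left K₁ hκpos hψc.continuousOn hψmono
    (fun s hs ↦ hψγ s hs)
  exact ⟨μ, hμ, by rw [hvel, hψ1]⟩

end BandData

end Literature.Topology.FourManifolds
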